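import Summits.QuantumFields.QCD.Theses.PauliWegnerSea
import Literature.MathematicalPhysics.QuantumLattice.OverlapLocality
import Literature.MathematicalPhysics.QuantumLattice.GaugeGroups
import Literature.MathematicalPhysics.QuantumFieldTheory.QCDPhaseQuenched
import Literature.MathematicalPhysics.QuantumFieldTheory.StrongCouplingActivities
import Literature.Analysis.Approximation.FiniteFamilyNikolskii
import Summits.QuantumFields.QCD.Theorems.PauliWegnerSeaFibreCofactorDominationNikolskiiPrep
import Summits.QuantumFields.QCD.Theorems.PauliWegnerSeaFibreCofactorDominationStubNikolskii

/-!
# Stubs `stub_detNikolskii` and `stub_cplus_of_crux` of crux `FibreCofactorDomination`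
(stmt-QuantumFields-11510), line `Sketch-ideator3` (card A `random-refit-second-moment`)

1. `stub_detNikolskii` — **two-star Nikolskii inequality for the determinant**: for every bare
   mass, torus, background `U`, sites `x, y` and fibre point `W₀`,
   `|det D_W(refit W₀)|² ≤ C_D ∫ |det D_W(refit W)|² dHaar^{⊗E}(W)` with `C_D` absolute.  Same
   machinery as the landed `stub_nikolskii`: as a function of ONE link the determinant lies in
   `P ^ 24` (`det_wilsonDirac_update_mem`, Leibniz; `P = span{1, g_{ab}, conj g_{ab}}`), the
   one-link Nikolskii inequality `nikolskii_span_pow`, and peeling the `≤ 16` star links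
   (`pi_nikolskii`).
2. `stub_cplus_of_crux` — **the crux implies its mean-square transfer C⁺** (with a mass-dependent
   constant, as in the crux): from `FibreCofactorDomination` at bare mass `m₀`, the window count
   obeys `n_w ≤ #roots ≤ 12L⁴`, so `Σ|adj_xy| ≤ C₀(1+12L⁴)|det(refit W′)|` for some `W′`; squaring,
   `Σ|adj|² ≤ (Σ|adj|)²`, and `stub_detNikolskii` bound the integrand of the second moment of the
   adjugate block pointwise by `C₀² C_D (1+12L⁴)² ∫det²`; integrate over the probability measure.
   Together with the lead's composition (`Lines/Sketch_ideator3.lean`: C⁺ ∧ Nikolskii ∧ … ⇒ crux)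
   this makes the residual stub `stub_meanSquare` (C⁺ on `m₀ ∈ [−2,0]`) EQUIVALENT to the crux
   restricted to light masses.
-/

noncomputable section

namespace Summit.QuantumFields.QCD.Theorems.RandomRefit

open scoped BigOperators Matrix
open MeasureTheory Filter Literature.MathematicalPhysics.QuantumFieldTheory
  Literature.MathematicalPhysics.QuantumLattice Literature.Probability.LatticeModels
  Literature.Analysis.Approximation

variable {L : ℕ}

/-! ### One-link polynomial structure of the determinant -/

/-- As a function of one link variable `g = V(e) ∈ SU(3)` (all other links frozen),
`det D_W(V[e ↦ g])` lies in `P ^ n`, `n ≥ 24`, for every submodule `P ∋ 1, g_{ab}, conj g_{ab}`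
of the function algebra (Leibniz: `g`, `ḡ` enter only the `≤ 24` rows at the endpoints of `e`,
affinely). -/
theorem det_wilsonDirac_update_mem [NeZero L] (P : Submodule ℂ (SU3 → ℂ))
    (h1 : (1 : SU3 → ℂ) ∈ P)
    (hc : ∀ a b : Fin 3, (fun g : SU3 => (g : Matrix (Fin 3) (Fin 3) ℂ) a b) ∈ P)
    (hs : ∀ a b : Fin 3, (fun g : SU3 => star ((g : Matrix (Fin 3) (Fin 3) ℂ) a b)) ∈ P)
    (V : GaugeConfig 4 L SU3) (e : Edge 4 L) (m₀ r₀ : ℝ) (n : ℕ) (hn : 24 ≤ n) :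
    (fun g => (wilsonDirac (fundamentalRep (Fin 3)) (Function.update V e g) m₀ r₀).det) ∈
      P ^ n := by
  classical
  set M : Matrix (TorusSite 4 L × Fin 3 × Fin 4) (TorusSite 4 L × Fin 3 × Fin 4) (SU3 → ℂ) :=
    fun r c g => wilsonDirac (fundamentalRep (Fin 3)) (Function.update V e g) m₀ r₀ r c with hM
  have hfun : (fun g => (wilsonDirac (fundamentalRep (Fin 3)) (Function.update V e g) m₀ r₀).det)
      = M.det := by
    funext g
    have h := RingHom.map_det (Pi.evalRingHom (fun _ : SU3 => ℂ) g) M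
    have hMg : (Pi.evalRingHom (fun _ : SU3 => ℂ) g).mapMatrix M =
        wilsonDirac (fundamentalRep (Fin 3)) (Function.update V e g) m₀ r₀ := by
      ext r c; rfl
    rw [hMg] at h
    rw [← h]
    rfl
  rw [hfun, Matrix.det_apply]
  refine Submodule.sum_mem _ fun σ _ => ?_
  rw [Units.smul_def]
  refine zsmul_mem ?_ _
  set d : TorusSite 4 L × Fin 3 × Fin 4 → ℕ := fun r =>
    if r.1 = e.1 ∨ r.1 = e.1.shift e.2 then 1 else 0 with hd
  have hentry : ∀ r c, M r c ∈ P ^ d r := fun r c =>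
    wilsonDirac_update_entry_mem P h1 hc hs V e m₀ r₀ r c
  have hprod := prod_mem_pow P Finset.univ (fun i => M (σ i) i) (fun i => d (σ i))
    fun i _ => hentry (σ i) i
  have hsum : ∑ i, d (σ i) = ∑ r, d r := Equiv.sum_comp σ d
  have hle : ∑ r, d r ≤ 24 := sum_rowWeight_le e.1 (e.1.shift e.2)
  exact pow_le_pow_right₀ (Submodule.one_le.mpr h1) ((hsum.trans_le hle).trans hn) hprod

/-! ### Two-star Nikolskii for the determinant from the one-link inequality -/

/-- **Two-star Nikolskii for `det`, abstract refit form**: if the one-link Nikolskii inequality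
holds with constant `C ≥ 1` on `P ^ n` (`n ≥ 24`), then for every refit map reading only the
`≤ 16` links of `S`, `|det D_W(refit W₀)|² ≤ C ^ 16 ∫ |det D_W(refit W)|² dHaar^{⊗E}(W)`. -/
theorem det_twoStar_nikolskii_of_oneLink [NeZero L] (P : Submodule ℂ (SU3 → ℂ))
    (h1 : (1 : SU3 → ℂ) ∈ P)
    (hc : ∀ a b : Fin 3, (fun g : SU3 => (g : Matrix (Fin 3) (Fin 3) ℂ) a b) ∈ P)
    (hs : ∀ a b : Fin 3, (fun g : SU3 => star ((g : Matrix (Fin 3) (Fin 3) ℂ) a b)) ∈ P)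
    (n : ℕ) (hn : 24 ≤ n) (C : NNReal) (h1C : 1 ≤ C)
    (hC : ∀ f ∈ P ^ n, Continuous f ∧ ∀ g₀ : SU3, ENNReal.ofReal (‖f g₀‖ ^ 2) ≤
      C * ∫⁻ g, ENNReal.ofReal (‖f g‖ ^ 2) ∂(haarProbability SU3))
    (m₀ r₀ : ℝ) (refit : GaugeConfig 4 L SU3 → GaugeConfig 4 L SU3)
    (hrefit : Continuous refit) (S : Finset (Edge 4 L)) (hcard : S.card ≤ 16)
    (hS : ∀ e ∈ S, ∀ (W : GaugeConfig 4 L SU3) (g : SU3),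
      refit (Function.update W e g) = Function.update (refit W) e g)
    (hnS : ∀ e ∉ S, ∀ (W : GaugeConfig 4 L SU3) (g : SU3), refit (Function.update W e g) = refit W)
    (W₀ : GaugeConfig 4 L SU3) :
    ‖(wilsonDirac (fundamentalRep (Fin 3)) (refit W₀) m₀ r₀).det‖ ^ 2 ≤
      (C : ℝ) ^ 16 * ∫ W, ‖(wilsonDirac (fundamentalRep (Fin 3)) (refit W) m₀ r₀).det‖ ^ 2
        ∂(Measure.pi fun _ : Edge 4 L => haarProbability SU3) := by
  classical
  set ν : Measure SU3 := haarProbability SU3 with hν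
  set Φ : GaugeConfig 4 L SU3 → ENNReal := fun W =>
    ENNReal.ofReal (‖(wilsonDirac (fundamentalRep (Fin 3)) (refit W) m₀ r₀).det‖ ^ 2) with hΦ
  have hQc : Continuous fun V : GaugeConfig 4 L SU3 =>
      ‖(wilsonDirac (fundamentalRep (Fin 3)) V m₀ r₀).det‖ ^ 2 :=
    ((continuous_wilsonDirac (L := L) (fundamentalRep (Fin 3))
      (continuous_fundamentalRep (Fin 3)) m₀ r₀).matrix_det.norm.pow 2)
  have hΦm : Measurable Φ := ((hQc.comp hrefit).measurable).ennreal_ofReal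
  have hlink : ∀ (V : GaugeConfig 4 L SU3) (e : Edge 4 L) (g₀ : SU3),
      ENNReal.ofReal (‖(wilsonDirac (fundamentalRep (Fin 3)) (Function.update V e g₀) m₀ r₀).det‖ ^ 2)
        ≤ C * ∫⁻ g, ENNReal.ofReal
          (‖(wilsonDirac (fundamentalRep (Fin 3)) (Function.update V e g) m₀ r₀).det‖ ^ 2) ∂ν :=
    fun V e g₀ => (hC _ (det_wilsonDirac_update_mem P h1 hc hs V e m₀ r₀ n hn)).2 g₀
  have hSΦ : ∀ e ∈ S, ∀ W, Φ W ≤ C * ∫⁻ g, Φ (Function.update W e g) ∂ν := by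
    intro e he W
    have h := hlink (refit W) e (refit W e)
    rw [Function.update_eq_self] at h
    simpa only [hΦ, hS e he] using h
  have hnSΦ : ∀ e ∉ S, ∀ W g, Φ (Function.update W e g) = Φ W := by
    intro e he W g
    simp only [hΦ, hnS e he]
  have hmain := pi_nikolskii ν Φ hΦm S (C : ENNReal) ENNReal.coe_ne_top hSΦ hnSΦ W₀
  have hC16 : (C : ENNReal) ^ S.card ≤ (C : ENNReal) ^ 16 :=
    pow_le_pow_right₀ (by exact_mod_cast h1C) hcard
  have hint : Integrable (fun W => ‖(wilsonDirac (fundamentalRep (Fin 3)) (refit W) m₀ r₀).det‖ ^ 2)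
      (Measure.pi fun _ : Edge 4 L => ν) :=
    (hQc.comp hrefit).integrable_of_hasCompactSupport (HasCompactSupport.of_compactSpace _)
  have hI0 : 0 ≤ ∫ W, ‖(wilsonDirac (fundamentalRep (Fin 3)) (refit W) m₀ r₀).det‖ ^ 2
      ∂(Measure.pi fun _ : Edge 4 L => ν) := integral_nonneg fun _ => by positivity
  have hlin : ∫⁻ W, Φ W ∂(Measure.pi fun _ : Edge 4 L => ν) =
      ENNReal.ofReal (∫ W, ‖(wilsonDirac (fundamentalRep (Fin 3)) (refit W) m₀ r₀).det‖ ^ 2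
        ∂(Measure.pi fun _ : Edge 4 L => ν)) := by
    rw [ofReal_integral_eq_lintegral_ofReal hint (ae_of_all _ fun _ => by positivity)]
  have hfin : Φ W₀ ≤ ENNReal.ofReal ((C : ℝ) ^ 16 *
      ∫ W, ‖(wilsonDirac (fundamentalRep (Fin 3)) (refit W) m₀ r₀).det‖ ^ 2
        ∂(Measure.pi fun _ : Edge 4 L => ν)) := by
    calc Φ W₀ ≤ (C : ENNReal) ^ S.card * ∫⁻ W, Φ W ∂(Measure.pi fun _ : Edge 4 L => ν) := hmain
      _ ≤ (C : ENNReal) ^ 16 * ∫⁻ W, Φ W ∂(Measure.pi fun _ : Edge 4 L => ν) :=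
          mul_le_mul' hC16 le_rfl
      _ = _ := by
          rw [hlin, ENNReal.ofReal_mul (by positivity), ENNReal.ofReal_pow NNReal.zero_le_coe,
            ENNReal.ofReal_coe_nnreal]
  exact (ENNReal.ofReal_le_ofReal_iff (mul_nonneg (by positivity) hI0)).mp hfin

/-- **Two-star Nikolskii inequality for the determinant** (registered stub `stub_detNikolskii`
of crux stmt-QuantumFields-11510, line Sketch-ideator3): `|det D_W(refit W₀)|²` is at most an
absolute constant times its product-Haar mean over the fibre. -/
theorem stub_detNikolskii : ∃ CD : ℝ, 0 < CD ∧ ∀ (m₀ : ℝ) (L : ℕ) [NeZero L]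
    (U : GaugeConfig 4 L (Matrix.specialUnitaryGroup (Fin 3) ℂ)) (x y : TorusSite 4 L) (W₀ : GaugeConfig 4 L (Matrix.specialUnitaryGroup (Fin 3) ℂ)),
    ‖(wilsonDirac (fundamentalRep (Fin 3)) (fun e => if e.1 = x ∨ Site.shift e.1 e.2 = x ∨ e.1 = y ∨ Site.shift e.1 e.2 = y then W₀ e else U e) m₀ 1).det‖ ^ 2 ≤
      CD * ∫ W, ‖(wilsonDirac (fundamentalRep (Fin 3)) (fun e => if e.1 = x ∨ Site.shift e.1 e.2 = x ∨ e.1 = y ∨ Site.shift e.1 e.2 = y then W e else U e) m₀ 1).det‖ ^ 2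
        ∂(Measure.pi fun _ : Edge 4 L => haarProbability (Matrix.specialUnitaryGroup (Fin 3) ℂ)) := by
  classical
  set gen : Unit ⊕ (Fin 3 × Fin 3) ⊕ (Fin 3 × Fin 3) → SU3 → ℂ :=
    Sum.elim (fun _ _ => (1 : ℂ)) (Sum.elim (fun ab g => (g : Matrix (Fin 3) (Fin 3) ℂ) ab.1 ab.2)
      (fun ab g => star ((g : Matrix (Fin 3) (Fin 3) ℂ) ab.1 ab.2))) with hgen
  have hgc : ∀ j, Continuous (gen j) := by
    rintro (_ | ⟨a, b⟩ | ⟨a, b⟩) <;> simp only [hgen, Sum.elim_inl, Sum.elim_inr]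
    · exact continuous_const
    · exact continuous_subtype_val.matrix_elem a b
    · exact (continuous_subtype_val.matrix_elem a b).star
  have hgb : ∀ j g, ‖gen j g‖ ≤ 1 := by
    rintro (_ | ⟨a, b⟩ | ⟨a, b⟩) g <;> simp only [hgen, Sum.elim_inl, Sum.elim_inr]
    · simp
    · exact entry_norm_bound_of_unitary g.2.1 a b
    · rw [norm_star]; exact entry_norm_bound_of_unitary g.2.1 a b
  obtain ⟨C, h1C, hC⟩ := nikolskii_span_pow (haarProbability SU3) gen hgc hgb 24
  have hP1 : (1 : SU3 → ℂ) ∈ Submodule.span ℂ (Set.range gen) :=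
    Submodule.subset_span ⟨Sum.inl (), by rw [hgen]; rfl⟩
  have hPc : ∀ a b : Fin 3, (fun g : SU3 => (g : Matrix (Fin 3) (Fin 3) ℂ) a b) ∈
      Submodule.span ℂ (Set.range gen) := fun a b =>
    Submodule.subset_span ⟨Sum.inr (Sum.inl (a, b)), by rw [hgen]; rfl⟩
  have hPs : ∀ a b : Fin 3, (fun g : SU3 => star ((g : Matrix (Fin 3) (Fin 3) ℂ) a b)) ∈
      Submodule.span ℂ (Set.range gen) := fun a b =>
    Submodule.subset_span ⟨Sum.inr (Sum.inr (a, b)), by rw [hgen]; rfl⟩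
  refine ⟨(C : ℝ) ^ 16, by positivity, fun m₀ L _ U x y W₀ => ?_⟩
  have hS : ∀ e ∈ (Finset.univ.filter fun e : Edge 4 L =>
      e.1 = x ∨ e.1.shift e.2 = x ∨ e.1 = y ∨ e.1.shift e.2 = y),
      ∀ (W : GaugeConfig 4 L SU3) (g : SU3),
        (fun e' => if e'.1 = x ∨ e'.1.shift e'.2 = x ∨ e'.1 = y ∨ e'.1.shift e'.2 = y then
            Function.update W e g e' else U e') =
          Function.update (fun e' => if e'.1 = x ∨ e'.1.shift e'.2 = x ∨ e'.1 = y ∨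
            e'.1.shift e'.2 = y then W e' else U e') e g := fun e he W g =>
    refit_update_of_mem (fun e' : Edge 4 L => e'.1 = x ∨ e'.1.shift e'.2 = x ∨ e'.1 = y ∨
      e'.1.shift e'.2 = y) U W e g (Finset.mem_filter.mp he).2
  have hnS : ∀ e ∉ (Finset.univ.filter fun e : Edge 4 L =>
      e.1 = x ∨ e.1.shift e.2 = x ∨ e.1 = y ∨ e.1.shift e.2 = y),
      ∀ (W : GaugeConfig 4 L SU3) (g : SU3),
        (fun e' => if e'.1 = x ∨ e'.1.shift e'.2 = x ∨ e'.1 = y ∨ e'.1.shift e'.2 = y then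
            Function.update W e g e' else U e') =
          fun e' => if e'.1 = x ∨ e'.1.shift e'.2 = x ∨ e'.1 = y ∨ e'.1.shift e'.2 = y then
            W e' else U e' := fun e he W g =>
    refit_update_of_not_mem (fun e' : Edge 4 L => e'.1 = x ∨ e'.1.shift e'.2 = x ∨ e'.1 = y ∨
      e'.1.shift e'.2 = y) U W e g (by simpa only [Finset.mem_filter, Finset.mem_univ, true_and] using he)
  exact det_twoStar_nikolskii_of_oneLink (Submodule.span ℂ (Set.range gen)) hP1 hPc hPs 24 le_rfl C
    h1C hC m₀ 1
    (fun W e' => if e'.1 = x ∨ e'.1.shift e'.2 = x ∨ e'.1 = y ∨ e'.1.shift e'.2 = y then W e'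
      else U e')
    (continuous_refit (fun e' : Edge 4 L => e'.1 = x ∨ e'.1.shift e'.2 = x ∨ e'.1 = y ∨
      e'.1.shift e'.2 = y) U) _ (card_twoStar_le x y) hS hnS W₀

/-! ### The crux implies its mean-square transfer C⁺ -/

/-- `Σ u² ≤ (Σ u)²` over the `144` block indices, for non-negative `u`. -/
theorem sum4_sq_le_sq_sum4 (u : Fin 3 → Fin 4 → Fin 3 → Fin 4 → ℝ) (hu : ∀ a i b j, 0 ≤ u a i b j) :
    (∑ a, ∑ i, ∑ b, ∑ j, u a i b j ^ 2) ≤ (∑ a, ∑ i, ∑ b, ∑ j, u a i b j) ^ 2 := by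
  have key : ∀ (s : Finset (Fin 3 × Fin 4 × Fin 3 × Fin 4))
      (f : Fin 3 × Fin 4 × Fin 3 × Fin 4 → ℝ), (∀ k, 0 ≤ f k) →
      (∑ k ∈ s, f k ^ 2) ≤ (∑ k ∈ s, f k) ^ 2 := fun s f hf =>
    Finset.sum_sq_le_sq_sum_of_nonneg fun k _ => hf k
  have h := key Finset.univ (fun k => u k.1 k.2.1 k.2.2.1 k.2.2.2) fun k => hu _ _ _ _
  simpa only [Fintype.sum_prod_type] using h

/-- The in-window count never exceeds the dimension: `countP ≤ #roots ≤ natDegree = 12L⁴`. -/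
theorem countP_roots_charpoly_le_card [NeZero L] (θ₀ m₀ : ℝ) (V : GaugeConfig 4 L SU3) :
    (Multiset.countP (fun z : ℂ => |z.re| < θ₀)
        (spinorLift gammaFive * wilsonDirac (fundamentalRep (Fin 3)) V m₀ 1).charpoly.roots : ℝ) ≤
      (Fintype.card (TorusSite 4 L × Fin 3 × Fin 4) : ℝ) := by
  have h1 := Multiset.countP_le_card (fun z : ℂ => |z.re| < θ₀)
    (spinorLift gammaFive * wilsonDirac (fundamentalRep (Fin 3)) V m₀ 1).charpoly.roots
  have h2 := Polynomial.card_roots'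
    (spinorLift gammaFive * wilsonDirac (fundamentalRep (Fin 3)) V m₀ 1).charpoly
  rw [Matrix.charpoly_natDegree_eq_dim] at h2
  exact_mod_cast h1.trans h2

/-- **The crux implies C⁺ (mass-dependent constant)** (registered stub `stub_cplus_of_crux` of
crux stmt-QuantumFields-11510, line Sketch-ideator3).  With the lead's composition this makes
the residual stub `stub_meanSquare` equivalent to the crux on light masses. -/
theorem stub_cplus_of_crux : Summit.QuantumFields.QCD.Theses.PauliWegnerSea.FibreCofactorDomination →
    ∀ (m₀ : ℝ), -2 ≤ m₀ → m₀ ≤ 0 → ∃ C : ℝ, 0 < C ∧ ∀ (L : ℕ) [NeZero L],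
    4 ≤ L → ∀ (U : GaugeConfig 4 L (Matrix.specialUnitaryGroup (Fin 3) ℂ)) (x y : TorusSite 4 L),
    x ≠ y →
    ∫ W, (∑ a : Fin 3, ∑ i : Fin 4, ∑ b : Fin 3, ∑ j : Fin 4,
        ‖(wilsonDirac (fundamentalRep (Fin 3)) (fun e => if e.1 = x ∨ Site.shift e.1 e.2 = x ∨ e.1 = y ∨ Site.shift e.1 e.2 = y then W e else U e) m₀ 1).adjugate (x, a, i) (y, b, j)‖ ^ 2)
        ∂(Measure.pi fun _ : Edge 4 L => haarProbability (Matrix.specialUnitaryGroup (Fin 3) ℂ)) ≤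
      C * (1 + (Fintype.card (TorusSite 4 L × Fin 3 × Fin 4) : ℝ)) ^ 2 *
        ∫ W, ‖(wilsonDirac (fundamentalRep (Fin 3)) (fun e => if e.1 = x ∨ Site.shift e.1 e.2 = x ∨ e.1 = y ∨ Site.shift e.1 e.2 = y then W e else U e) m₀ 1).det‖ ^ 2
          ∂(Measure.pi fun _ : Edge 4 L => haarProbability (Matrix.specialUnitaryGroup (Fin 3) ℂ)) := by
  intro hK m₀ hm₁ hm₂
  obtain ⟨CD, hCD, hD⟩ := stub_detNikolskii
  obtain ⟨θ₀, C₀, _hθ₀, hC₀, hcrux⟩ := hK m₀ hm₁ (by linarith)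
  refine ⟨C₀ ^ 2 * CD, by positivity, ?_⟩
  intro L _ hL U x y hxy
  have hc := hcrux L hL U x y hxy
  dsimp only at hc
  set ID : ℝ := ∫ W, ‖(wilsonDirac (fundamentalRep (Fin 3)) (fun e => if e.1 = x ∨
      Site.shift e.1 e.2 = x ∨ e.1 = y ∨ Site.shift e.1 e.2 = y then W e else U e) m₀ 1).det‖ ^ 2
      ∂(Measure.pi fun _ : Edge 4 L => haarProbability SU3) with hID
  set card : ℝ := (Fintype.card (TorusSite 4 L × Fin 3 × Fin 4) : ℝ) with hcard
  have hID0 : 0 ≤ ID := integral_nonneg fun _ => by positivity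
  have hcard0 : 0 ≤ card := Nat.cast_nonneg _
  -- pointwise bound of the integrand
  have hQ : ∀ W : GaugeConfig 4 L SU3,
      (∑ a : Fin 3, ∑ i : Fin 4, ∑ b : Fin 3, ∑ j : Fin 4,
        ‖(wilsonDirac (fundamentalRep (Fin 3)) (fun e => if e.1 = x ∨ Site.shift e.1 e.2 = x ∨
          e.1 = y ∨ Site.shift e.1 e.2 = y then W e else U e) m₀ 1).adjugate (x, a, i) (y, b, j)‖ ^ 2)
        ≤ C₀ ^ 2 * CD * (1 + card) ^ 2 * ID := by
    intro W
    obtain ⟨W', hW'⟩ := hc W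
    have hnw := countP_roots_charpoly_le_card (L := L) θ₀ m₀ U
    have hdet := hD m₀ L U x y W'
    set A : ℝ := ∑ a : Fin 3, ∑ i : Fin 4, ∑ b : Fin 3, ∑ j : Fin 4,
      ‖(wilsonDirac (fundamentalRep (Fin 3)) (fun e => if e.1 = x ∨ Site.shift e.1 e.2 = x ∨
        e.1 = y ∨ Site.shift e.1 e.2 = y then W e else U e) m₀ 1).adjugate (x, a, i) (y, b, j)‖
      with hA
    set dW : ℝ := ‖(wilsonDirac (fundamentalRep (Fin 3)) (fun e => if e.1 = x ∨
      Site.shift e.1 e.2 = x ∨ e.1 = y ∨ Site.shift e.1 e.2 = y then W' e else U e) m₀ 1).det‖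
      with hdW
    have hA0 : 0 ≤ A := by positivity
    have hdW0 : 0 ≤ dW := norm_nonneg _
    have hAle : A ≤ C₀ * (1 + card) * dW := by
      refine hW'.trans ?_
      gcongr
    calc (∑ a : Fin 3, ∑ i : Fin 4, ∑ b : Fin 3, ∑ j : Fin 4,
          ‖(wilsonDirac (fundamentalRep (Fin 3)) (fun e => if e.1 = x ∨ Site.shift e.1 e.2 = x ∨
            e.1 = y ∨ Site.shift e.1 e.2 = y then W e else U e) m₀ 1).adjugate
              (x, a, i) (y, b, j)‖ ^ 2)
        ≤ A ^ 2 := sum4_sq_le_sq_sum4 _ fun _ _ _ _ => norm_nonneg _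
      _ ≤ (C₀ * (1 + card) * dW) ^ 2 := pow_le_pow_left₀ hA0 hAle 2
      _ = C₀ ^ 2 * (1 + card) ^ 2 * dW ^ 2 := by ring
      _ ≤ C₀ ^ 2 * (1 + card) ^ 2 * (CD * ID) := by gcongr
      _ = C₀ ^ 2 * CD * (1 + card) ^ 2 * ID := by ring
  -- integrate over the probability measure
  have hK0 : 0 ≤ C₀ ^ 2 * CD * (1 + card) ^ 2 * ID := by positivity
  by_cases hint : Integrable (fun W : GaugeConfig 4 L SU3 =>
      ∑ a : Fin 3, ∑ i : Fin 4, ∑ b : Fin 3, ∑ j : Fin 4,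
        ‖(wilsonDirac (fundamentalRep (Fin 3)) (fun e => if e.1 = x ∨ Site.shift e.1 e.2 = x ∨
          e.1 = y ∨ Site.shift e.1 e.2 = y then W e else U e) m₀ 1).adjugate (x, a, i) (y, b, j)‖ ^ 2)
      (Measure.pi fun _ : Edge 4 L => haarProbability SU3)
  · calc _ ≤ ∫ _W : GaugeConfig 4 L SU3, C₀ ^ 2 * CD * (1 + card) ^ 2 * ID
          ∂(Measure.pi fun _ : Edge 4 L => haarProbability SU3) :=
          integral_mono hint (integrable_const _) hQ
      _ = C₀ ^ 2 * CD * (1 + card) ^ 2 * ID := by simp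
  · rw [integral_undef hint]
    exact hK0

end Summit.QuantumFields.QCD.Theorems.RandomRefit

end
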